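import Summits.BirchSwinnertonDyer.BirchSwinnertonDyer.Theorems.GenusKolyvaginAtTwoPowDvdShaCardAtTwoRTRankZeroSide
import Literature.NumberTheory.EllipticCurves.SelmerGroupCardinality
import Literature.NumberTheory.EllipticCurves.HeegnerPointsOfConductorOneGaloisConjProofs
import Literature.NumberTheory.EllipticCurves.BSDSelmerPConverseYanZhuKolyvaginSystemProofs
import HarnessLib

/-!
# Route `GenusKolyvaginAtTwo`, crux U⁺_T `ShaCardDvdPowAtTwoPosT` (stmt-BirchSwinnertonDyer-23378), LINE «rational_pair_descent_pos» —
# TWINPOINT (sign-free, `K`-side-free, Q2-free): with `w(E) = +1`, `y_K` of infinite order and a 2-Selmer-minimal twin,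
# `rank Wd(ℚ) = 1` and `Ш(Wd/ℚ)[2^∞] = 0`

Seat `bsd-line-gk2-p1` g20 (LEAD, cell `bsd-f1-sign2`), `--supports stmt-BirchSwinnertonDyer-23378` (helper; closes nothing).
THEOREMS ONLY (no definition, no named fact, no `sorry`).  BSD is NOT proved by any of this; U⁺_T is NOT proved.

WHY.  On the Δ<0 live reach the twin's data (`rank Wd(ℚ) = 1`, `Ш(Wd/ℚ)[2^∞] = 0`; gk2-p5 g29 `…RTShaFiniteAtTwoTwinShaTrivial`) were read off
Kolyvagin's `rank E(K) = 1` AT 2 (`mordellWeilRank_baseChange_eq_one_onHabitat`, which needs `Δ(E) < 0` and an odd multiplicative prime).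
For the Δ>0 half U⁺_T (and for any descent that takes «a 2-Selmer-minimal twin WITH a rational point of infinite order» as input, e.g.
gk2-p3 g27's DESC⁺) the same conclusions hold with NO `K`-side input and NO sign hypothesis: Gross's Prop. 5.3 (`τ y_K = −w(E)·y_K` up to
torsion, tree `X11b.KolyvaginBottom.isOfFinAddOrder_map_sub_neg_rootNumber_smul`, PROVED) makes `y_K − τ y_K` an anti-fixed point of
infinite order when `w(E) = +1`, which descends to `E^(d_K)(ℚ)` (gk2-p2 g18 `one_le_mordellWeilRank_quadraticTwist_of_map_eq_neg`), so
`rank Wd(ℚ) ≥ 1`; the descent count `#Sel₂(Wd) = 2^rank · #Wd(ℚ)[2] · #Ш(Wd/ℚ)[2]` (AEC X.4.2, `card_selmerGroup_eq_pow_rank_mul`) with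
`#Sel₂(Wd) = 2` then forces `rank = 1` and `Ш(Wd/ℚ)[2] = 0`; a `2`-primary group without elements of order `2` is trivial.

* §1 `one_le_mordellWeilRank_twin_of_rootNumber_eq_one` (Heegner point form) and `…_of_derivedPoint` (`y_K = P(1)` form).
* §2 `twin_descentCount_of_rootNumber_eq_one_signFree`, `mordellWeilRank_twin_eq_one_signFree`, `natCard_sha_inf_torsionBy_two_twin_eq_one_signFree`.
* §3 `forall_primaryComponent_sha_twin_two_eq_zero_signFree`, `natCard_primaryComponent_sha_twin_two_eq_one_signFree`.

References: [GrossLMS1991] Thm. 1.3, §5 Prop. 5.3; [Darmon2004] Prop. 3.11, §3.9; [SilvermanAEC2009] Thm. X.4.2 (a), X.5 Cor. 5.4,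
Exercise 10.16; [MazurRubin2010] §1 (2-Selmer-minimal twists).
-/

set_option autoImplicit false
-- the Theorems namespace of this sub repeats the summit name by design (D-0017 nested layout)
set_option linter.dupNamespace false

noncomputable section

open scoped Classical
open scoped AddSubgroup

namespace Summit.BirchSwinnertonDyer.BirchSwinnertonDyer.Theorems.GenusExact.RationalPairDescent

open WeierstrassCurve NumberField Field Literature.NumberTheory.EllipticCurves
  Literature.NumberTheory.GaloisRepresentations Literature.NumberTheory.EllipticCurves.ModularForms AddSubgroup
open Summit.BirchSwinnertonDyer.BirchSwinnertonDyer.Theorems.GenusExact.PlusDescent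

variable (K : Type) [Field K] [NumberField K]

/-! ## §1 `rank Wd(ℚ) ≥ 1` from `w(E) = +1` and a Heegner point of infinite order -/

/-- **`w(E) = +1` and a Heegner point `P ∈ E(K)` of infinite order give `rank Wd(ℚ) ≥ 1`** for every elliptic `ℚ`-model `Wd` of `E^(d_K)`:
by Gross's Prop. 5.3 (`τP + w(E)P ∈ E(K)_tors`, PROVED in the tree) the point `P − τP` is `τ`-anti-fixed, and it has infinite order
(else `2P = (P − τP) + (τP + P)` would be torsion); an anti-fixed `K`-point of infinite order descends to `E^(d_K)(ℚ)`.  No `K`-side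
(Kolyvagin) input, no hypothesis on the sign of `Δ(E)`, no Galois-image hypothesis. [cite: GrossLMS1991, §5 Prop. 5.3]
[cite: Darmon2004, Prop. 3.11 and §3.9] [cite: SilvermanAEC2009, X.5 Cor. 5.4, Exercise 10.16] -/
theorem one_le_mordellWeilRank_twin_of_rootNumber_eq_one (W : WeierstrassCurve ℚ) [W.IsElliptic] [W.IsGloballyMinimal]
    [NeZero (W.conductorNorm ℤ)] (hIQ : IsImaginaryQuadratic K) (hH : SatisfiesHeegnerHypothesis (W.conductorNorm ℤ) K)
    {P : (W.baseChange K).toAffine.Point} (hP : IsHeegnerPoint (W.conductorNorm ℤ) W K P) (hnt : ¬ IsOfFinAddOrder P)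
    (hw1 : W.rootNumber = 1)
    (Wd : WeierstrassCurve ℚ) [Wd.IsElliptic] (hWd : ∃ C : VariableChange ℚ, C • W.quadraticTwist (NumberField.discr K : ℚ) = Wd) :
    1 ≤ Wd.mordellWeilRank := by
  have h2 : Module.finrank ℚ K = 2 := hIQ.1
  haveI : IsGalois ℚ K := isGalois_of_finrank_eq_two K h2
  obtain ⟨τ, θ₀, hτ, hθ₀, hsq, hτθ, hall⟩ := exists_gal_ne_one_sqrt_discr (K := K) h2
  have hdK : (NumberField.discr K : ℚ) ≠ 0 := by exact_mod_cast NumberField.discr_ne_zero K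
  obtain ⟨Cd, rfl⟩ := hWd
  haveI := W.isElliptic_quadraticTwist hdK
  -- Gross: `τ P − (−w(E)) P = τP + P` is torsion (`w = 1`)
  have hgross := Summit.BirchSwinnertonDyer.Rank1Residual.X11b.KolyvaginBottom.isOfFinAddOrder_map_sub_neg_rootNumber_smul
    (W := W) hIQ hH hP τ hτ
  rw [hw1] at hgross
  have hPτ2 : WeierstrassCurve.Affine.Point.map (W' := W) (τ : K →ₐ[ℚ] K)
      (WeierstrassCurve.Affine.Point.map (W' := W) (τ : K →ₐ[ℚ] K) P) = P := by
    have hττ : τ * τ = 1 := by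
      rcases hall (τ * τ) with h | h
      · exact h
      · exfalso; apply hτ
        have := congrArg (· * τ⁻¹) h
        simpa using this
    rw [WeierstrassCurve.Affine.Point.map_map]
    have : ((τ : K →ₐ[ℚ] K).comp (τ : K →ₐ[ℚ] K)) = AlgHom.id ℚ K := by
      ext x
      change τ (τ x) = x
      rw [← AlgEquiv.mul_apply, hττ, AlgEquiv.one_apply]
    rw [this]
    cases P <;> rfl
  set τP := WeierstrassCurve.Affine.Point.map (W' := W) (τ : K →ₐ[ℚ] K) P with hτP
  have hQanti : WeierstrassCurve.Affine.Point.map (W' := W) (τ : K →ₐ[ℚ] K) (P - τP) = -(P - τP) := by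
    rw [map_sub, hτP, hPτ2, neg_sub]
  have hQinf : ¬ IsOfFinAddOrder (P - τP) := by
    intro hfin
    -- `P − τP` torsion and `τP + P` torsion ⟹ `2P` torsion ⟹ `P` torsion
    have h2P : IsOfFinAddOrder (P + P) := by
      have : P + P = (P - τP) + (τP - (-(1 : ℤ)) • P) := by rw [neg_one_zsmul, sub_neg_eq_add]; abel
      rw [this]
      exact hfin.add hgross
    rw [← two_nsmul] at h2P
    exact hnt (h2P.of_nsmul two_ne_zero)
  have h1 := one_le_mordellWeilRank_quadraticTwist_of_map_eq_neg K W hdK hsq τ hτθ hall hQanti hQinf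
  rwa [(W.quadraticTwist (NumberField.discr K : ℚ)).mordellWeilRank_variableChange_holds Cd]

/-- **`w(E) = +1` and `y_K = P(1)` of infinite order give `rank Wd(ℚ) ≥ 1`** — §1 for the route's frames, where the Heegner point is
carried by a conductor-`1` Kolyvagin–Heegner datum `d₁` (`P(1) = Tr_{K[1]/K} y(1) = y_K` is the image of a `K`-rational Heegner point,
`heegnerSystem_exists_isHeegnerPoint_map_eq_derivedPoint_one` with the PROVED `heegnerPointOfConductor_one_galoisConj_holds`).
[cite: GrossLMS1991, §4 (P_1 = y_K), §5 Prop. 5.3] [cite: SilvermanAEC2009, Exercise 10.16] -/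
theorem one_le_mordellWeilRank_twin_of_rootNumber_eq_one_of_derivedPoint (W : WeierstrassCurve ℚ) [W.IsElliptic]
    [W.IsGloballyMinimal] [NeZero (W.conductorNorm ℤ)] (hIQ : IsImaginaryQuadratic K)
    (hH : SatisfiesHeegnerHypothesis (W.conductorNorm ℤ) K)
    (Dt : ModularParametrizationData W (W.conductorNorm ℤ)) (β : ℤ) (ι : K →+* ℂ) (d₁ : KolyvaginHeegnerData Dt β ι 1)
    (hy : ¬ IsOfFinAddOrder d₁.derivedPoint) (hw1 : W.rootNumber = 1)
    (Wd : WeierstrassCurve ℚ) [Wd.IsElliptic] (hWd : ∃ C : VariableChange ℚ, C • W.quadraticTwist (NumberField.discr K : ℚ) = Wd) :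
    1 ≤ Wd.mordellWeilRank := by
  obtain ⟨P₀, hHP, hP₀⟩ := heegnerSystem_exists_isHeegnerPoint_map_eq_derivedPoint_one
    (heegnerPointOfConductor_one_galoisConj_holds (W.conductorNorm ℤ) W K) hIQ hH d₁
  have hP₀nt : ¬ IsOfFinAddOrder P₀ := fun h ↦ hy (by rw [← hP₀]; exact AddMonoidHom.isOfFinAddOrder _ h)
  exact one_le_mordellWeilRank_twin_of_rootNumber_eq_one K W hIQ hH hHP hP₀nt hw1 Wd hWd

/-! ## §2 The descent count under `#Sel₂(Wd) = 2`: `rank Wd(ℚ) = 1`, `Ш(Wd/ℚ)[2] = 0` -/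

/-- **The 2-Selmer-minimal twin: `rank Wd(ℚ) = 1` and `#(Ш(Wd/ℚ) ∩ H¹(ℚ,Wd)[2]) = 1`** — from `rank Wd(ℚ) ≥ 1` (§1) and the descent count
`#Sel₂(Wd) = 2 = 2^rank · #Wd(ℚ)[2] · #Ш(Wd/ℚ)[2]` (AEC X.4.2 (a), tree `card_selmerGroup_eq_pow_rank_mul`): `2^rank ∣ 2` forces `rank = 1`, and then
the two finite factors multiply to `1`.  Sign-free, `K`-side-free. [cite: SilvermanAEC2009, Thm. X.4.2 (a)] [cite: MazurRubin2010, §1]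
[cite: GrossLMS1991, §5 Prop. 5.3] -/
theorem twin_descentCount_of_rootNumber_eq_one_signFree (W : WeierstrassCurve ℚ) [W.IsElliptic] [W.IsGloballyMinimal]
    [NeZero (W.conductorNorm ℤ)] (hIQ : IsImaginaryQuadratic K) (hH : SatisfiesHeegnerHypothesis (W.conductorNorm ℤ) K)
    (Dt : ModularParametrizationData W (W.conductorNorm ℤ)) (β : ℤ) (ι : K →+* ℂ) (d₁ : KolyvaginHeegnerData Dt β ι 1)
    (hy : ¬ IsOfFinAddOrder d₁.derivedPoint) (hw1 : W.rootNumber = 1)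
    (Wd : WeierstrassCurve ℚ) [Wd.IsElliptic] (hWd : ∃ C : VariableChange ℚ, C • W.quadraticTwist (NumberField.discr K : ℚ) = Wd)
    (hSel : Nat.card (Wd.selmerGroup 2) = 2) :
    Wd.mordellWeilRank = 1 ∧ Nat.card (Wd.sha ⊓ AddSubgroup.torsionBy Wd.galH1 (2 : ℕ) : AddSubgroup Wd.galH1) = 1 := by
  have h1 := one_le_mordellWeilRank_twin_of_rootNumber_eq_one_of_derivedPoint K W hIQ hH Dt β ι d₁ hy hw1 Wd hWd
  have hcount := card_selmerGroup_eq_pow_rank_mul Wd 2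
  simp only [Nat.cast_ofNat] at hcount
  rw [hSel] at hcount
  -- `2^rank ∣ 2` ⟹ `rank ≤ 1`
  have hdvd : 2 ^ Wd.mordellWeilRank ∣ 2 := by
    obtain ⟨c, hc⟩ : ∃ c, 2 = 2 ^ Wd.mordellWeilRank * c := ⟨_, by rw [mul_assoc] at hcount; exact hcount⟩
    exact ⟨c, hc⟩
  have hle : Wd.mordellWeilRank ≤ 1 := by
    have h2 : 2 ^ Wd.mordellWeilRank ∣ 2 ^ 1 := by rwa [pow_one]
    exact (Nat.pow_dvd_pow_iff_le_right (show 1 < 2 by norm_num)).mp h2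
  have hrank : Wd.mordellWeilRank = 1 := le_antisymm hle h1
  refine ⟨hrank, ?_⟩
  rw [hrank, pow_one, mul_assoc] at hcount
  -- `2 · 1 = 2 · (#Wd(ℚ)[2] · #(Ш ∩ H¹[2]))` forces the product, hence the second factor, to be `1`
  have hcd := Nat.eq_of_mul_eq_mul_left (show 0 < 2 by norm_num) ((mul_one 2).trans hcount)
  exact Nat.eq_one_of_mul_eq_one_left hcd.symm

/-- **`rank Wd(ℚ) = 1`** on the frame of §2. [cite: SilvermanAEC2009, Thm. X.4.2 (a)] [cite: GrossLMS1991, §5 Prop. 5.3] -/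
theorem mordellWeilRank_twin_eq_one_signFree (W : WeierstrassCurve ℚ) [W.IsElliptic] [W.IsGloballyMinimal]
    [NeZero (W.conductorNorm ℤ)] (hIQ : IsImaginaryQuadratic K) (hH : SatisfiesHeegnerHypothesis (W.conductorNorm ℤ) K)
    (Dt : ModularParametrizationData W (W.conductorNorm ℤ)) (β : ℤ) (ι : K →+* ℂ) (d₁ : KolyvaginHeegnerData Dt β ι 1)
    (hy : ¬ IsOfFinAddOrder d₁.derivedPoint) (hw1 : W.rootNumber = 1)
    (Wd : WeierstrassCurve ℚ) [Wd.IsElliptic] (hWd : ∃ C : VariableChange ℚ, C • W.quadraticTwist (NumberField.discr K : ℚ) = Wd)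
    (hSel : Nat.card (Wd.selmerGroup 2) = 2) :
    Wd.mordellWeilRank = 1 :=
  (twin_descentCount_of_rootNumber_eq_one_signFree K W hIQ hH Dt β ι d₁ hy hw1 Wd hWd hSel).1

/-- **`Ш(Wd/ℚ)[2] = 0`** (`#(Ш(Wd/ℚ) ∩ H¹(ℚ,Wd)[2]) = 1`) on the frame of §2. [cite: SilvermanAEC2009, Thm. X.4.2 (a)]
[cite: MazurRubin2010, §1] -/
theorem natCard_sha_inf_torsionBy_two_twin_eq_one_signFree (W : WeierstrassCurve ℚ) [W.IsElliptic] [W.IsGloballyMinimal]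
    [NeZero (W.conductorNorm ℤ)] (hIQ : IsImaginaryQuadratic K) (hH : SatisfiesHeegnerHypothesis (W.conductorNorm ℤ) K)
    (Dt : ModularParametrizationData W (W.conductorNorm ℤ)) (β : ℤ) (ι : K →+* ℂ) (d₁ : KolyvaginHeegnerData Dt β ι 1)
    (hy : ¬ IsOfFinAddOrder d₁.derivedPoint) (hw1 : W.rootNumber = 1)
    (Wd : WeierstrassCurve ℚ) [Wd.IsElliptic] (hWd : ∃ C : VariableChange ℚ, C • W.quadraticTwist (NumberField.discr K : ℚ) = Wd)
    (hSel : Nat.card (Wd.selmerGroup 2) = 2) :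
    Nat.card (Wd.sha ⊓ AddSubgroup.torsionBy Wd.galH1 (2 : ℕ) : AddSubgroup Wd.galH1) = 1 :=
  (twin_descentCount_of_rootNumber_eq_one_signFree K W hIQ hH Dt β ι d₁ hy hw1 Wd hWd hSel).2

/-! ## §3 `Ш(Wd/ℚ)[2^∞] = 0` -/

/-- **`Ш(Wd/ℚ)[2^∞] = 0` — sign-free, `K`-side-free**: every class of `Ш(Wd/ℚ)` of `2`-power order is `0`, since a non-zero one would have
a multiple of order exactly `2` in `Ш(Wd/ℚ)[2] = 0` (§2).  (Proof adapted verbatim from gk2-p5 g29's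
`forall_primaryComponent_sha_twin_two_eq_zero_onHabitat`, whose frame carried `Δ(E) < 0` and an odd multiplicative prime.)
[cite: SilvermanAEC2009, Thm. X.4.2 (a)] [cite: GrossLMS1991, Thm. 1.3, §5 Prop. 5.3] [cite: MazurRubin2010, §1] -/
theorem forall_primaryComponent_sha_twin_two_eq_zero_signFree (W : WeierstrassCurve ℚ) [W.IsElliptic] [W.IsGloballyMinimal]
    [NeZero (W.conductorNorm ℤ)] (hIQ : IsImaginaryQuadratic K) (hH : SatisfiesHeegnerHypothesis (W.conductorNorm ℤ) K)
    (Dt : ModularParametrizationData W (W.conductorNorm ℤ)) (β : ℤ) (ι : K →+* ℂ) (d₁ : KolyvaginHeegnerData Dt β ι 1)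
    (hy : ¬ IsOfFinAddOrder d₁.derivedPoint) (hw1 : W.rootNumber = 1)
    (Wd : WeierstrassCurve ℚ) [Wd.IsElliptic] (hWd : ∃ C : VariableChange ℚ, C • W.quadraticTwist (NumberField.discr K : ℚ) = Wd)
    (hSel : Nat.card (Wd.selmerGroup 2) = 2) :
    ∀ x ∈ AddCommGroup.primaryComponent Wd.sha 2, x = 0 := by
  have h1 := natCard_sha_inf_torsionBy_two_twin_eq_one_signFree K W hIQ hH Dt β ι d₁ hy hw1 Wd hWd hSel
  have hsub : Subsingleton (Wd.sha ⊓ AddSubgroup.torsionBy Wd.galH1 (2 : ℕ) : AddSubgroup Wd.galH1) := (Nat.card_eq_one_iff_unique.mp h1).1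
  intro x hx
  by_contra hx0
  obtain ⟨k, hk⟩ := (AddCommGroup.mem_primaryComponent).1 hx
  -- the order of `x` is `2^e` with `e ≥ 1`
  obtain ⟨e, -, he⟩ := (Nat.dvd_prime_pow Nat.prime_two).mp (addOrderOf_dvd_iff_nsmul_eq_zero.mpr hk)
  have he1 : 1 ≤ e := by
    by_contra h
    have h0 : e = 0 := by omega
    rw [h0, pow_zero, AddMonoid.addOrderOf_eq_one_iff] at he
    exact hx0 he
  -- `y = 2^(e-1) • x` has order exactly `2`
  set y : Wd.sha := 2 ^ (e - 1) • x with hy'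
  have hy2 : 2 • y = 0 := by
    rw [hy', ← mul_nsmul', ← pow_succ', Nat.sub_add_cancel he1, ← he]
    exact addOrderOf_nsmul_eq_zero x
  have hy0 : y ≠ 0 := by
    intro h
    have hdvd : addOrderOf x ∣ 2 ^ (e - 1) := addOrderOf_dvd_iff_nsmul_eq_zero.mpr (by rw [← hy']; exact h)
    rw [he, Nat.pow_dvd_pow_iff_le_right (by norm_num)] at hdvd
    omega
  -- `y ∈ Ш ∩ H¹(ℚ, Wd)[2]`, a trivial group
  have hymem : ((y : Wd.sha) : Wd.galH1) ∈ (Wd.sha ⊓ AddSubgroup.torsionBy Wd.galH1 (2 : ℕ) : AddSubgroup Wd.galH1) := by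
    refine AddSubgroup.mem_inf.mpr ⟨y.2, torsionBy.nsmul_iff.mpr ?_⟩
    rw [← AddSubgroupClass.coe_nsmul, hy2, ZeroMemClass.coe_zero]
  have h0 : (⟨((y : Wd.sha) : Wd.galH1), hymem⟩ : (Wd.sha ⊓ AddSubgroup.torsionBy Wd.galH1 (2 : ℕ) : AddSubgroup Wd.galH1)) =
      ⟨0, AddSubgroup.zero_mem _⟩ := Subsingleton.elim _ _
  have hval : ((y : Wd.sha) : Wd.galH1) = 0 := congrArg Subtype.val h0
  exact hy0 (Subtype.ext hval)

/-- **`#Ш(Wd/ℚ)[2^∞] = 1` — sign-free, `K`-side-free.** [cite: SilvermanAEC2009, Thm. X.4.2 (a)] [cite: MazurRubin2010, §1] -/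
theorem natCard_primaryComponent_sha_twin_two_eq_one_signFree (W : WeierstrassCurve ℚ) [W.IsElliptic] [W.IsGloballyMinimal]
    [NeZero (W.conductorNorm ℤ)] (hIQ : IsImaginaryQuadratic K) (hH : SatisfiesHeegnerHypothesis (W.conductorNorm ℤ) K)
    (Dt : ModularParametrizationData W (W.conductorNorm ℤ)) (β : ℤ) (ι : K →+* ℂ) (d₁ : KolyvaginHeegnerData Dt β ι 1)
    (hy : ¬ IsOfFinAddOrder d₁.derivedPoint) (hw1 : W.rootNumber = 1)
    (Wd : WeierstrassCurve ℚ) [Wd.IsElliptic] (hWd : ∃ C : VariableChange ℚ, C • W.quadraticTwist (NumberField.discr K : ℚ) = Wd)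
    (hSel : Nat.card (Wd.selmerGroup 2) = 2) :
    Nat.card (AddCommGroup.primaryComponent Wd.sha 2) = 1 := by
  rw [Nat.card_eq_one_iff_unique]
  refine ⟨⟨fun a b ↦ Subtype.ext ?_⟩, ⟨⟨0, AddSubgroup.zero_mem _⟩⟩⟩
  have h := forall_primaryComponent_sha_twin_two_eq_zero_signFree K W hIQ hH Dt β ι d₁ hy hw1 Wd hWd hSel
  rw [h a.1 a.2, h b.1 b.2]

end Summit.BirchSwinnertonDyer.BirchSwinnertonDyer.Theorems.GenusExact.RationalPairDescent

end
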